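import Mathlib

/-!
# MODEL-HUNT (abc-iut-inv-5, gen 3; KEY `pub/abc-iut/wake/KEY-abc-iut-inv-5-MODEL-HUNT.md` 6774fe0d90a025b9) —
# the DOOR THEOREM BY PRICE LOCALITY for an ARBITRARY family of «possible images», and the arithmetic locus on which
# Reading M AS TYPED is licensed (tame case)

Scratch sketch for crux stmt-ABC-19678 `Summit.ABC.ABC.Theses.IUTThetaPilot.ThetaPartII` (route-ABC-IUTThetaPilot, draft).
TAKES NO SIDE on [IUTchIII] Cor. 3.12 or on any author (D-0045): Reading SS / Reading M are author-labelled hypotheses of the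
instrument (`Cor312TwoReadingsSheetReal`); an identification object PROPOSED ≠ IUT repaired; interface ≠ construction;
typed ≠ inhabited ≠ proved; NO abc claim; MORATORIUM rq128 untouched (no model point is instantiated; nothing heavier than
`lean check` was run). Structures / defs / small theorems only; no `instance`, no `notation`, no `macro`; standard axioms.

WHAT IS TYPED (namespace `Summit.ABC.ABC.Cruxes.ThetaPartII.ModelHunt5`).

§1 `SlotLedger ι` — the VOLUME SHADOW of any «possible-images structure» 𝓜 at a witness setting, slot by slot
(`ι` = the finite set of (label, summand/place) slots that carry the comparison): `θ i` = log-volume of the honest Θ-copy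
at slot `i` (the `q^{j²}`-box), `κ i` = log-volume of the q-region there, `η i` = log-volume of the holomorphic hull of the
union of ALL images 𝓜 proposes at slot `i` (whatever they are: isometric movers, permuted tensor factors, (Ind3)-iterates,
dilations, label-mixing or place-coupled moves — only the hull's volume enters). Axioms NONE; the hypotheses are carried
inline: `HullCoversTheta` (`θ ≤ η`, hull ⊇ Θ-copy), `ThetaInsideQ` (`θ ≤ κ`, the Θ-cell lies in the q-cell:
`‖t_{Θ,j}‖ = ‖t_q‖^{j²} ≤ ‖t_q‖`, tree `IdentificationSocket.thetaRegion_subset_qContainer`), the volume shadow of the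
set-level (xi-f) licence `SetLicensed` (`κ ≤ η`, from `qRegion ⊆ thetaHull` by monotonicity of the packet measure, tree
`Literature.IUT.LogVolume.packetLogμ_mono`), and a PRICE in one of two localities: `PricedPlacewise B` (`η i ≤ θ i + B i` at
every slot — the shape of EVERY hull-volume theorem in the tree: [IUTchIV] Prop. 1.2 / Dupuy–Hilado, `DHData.negLogThetaLoc_le`,
inv-2's `BlurBudget.summandBlurBudget_holds`) or `PricedGlobal B` (`∑ η ≤ ∑ θ + ∑ B`, the shape of `HullEstimateOf` /
`B_III`). The delivered statements: `Delivers` (`∑ κ ≤ ∑ η`, the typed Corollary's shape `negLogQ ≤ negLogTheta`) and the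
height inequality `HeightIneq B` (`∑ (κ − θ) ≤ ∑ B`: NEED ≤ BLUR, the Szpiro shape — inv-2 (B2) `hullNeedsQuadratic_holds`
computes NEED = (avgSq ℓ⋇ − 1)·|log q|).
THE DOOR THEOREM BY PRICE LOCALITY (all proved, a few lines each):
* `need_le_blur_of_licensed_placewise` — licensed ∧ placewise-priced ⟹ `κ i − θ i ≤ B i` AT EVERY SLOT (a place-wise height
  inequality: MJ-HARVEST-1 row H1-03 `NoPlacewiseUniformSupplier` / `Repair.CandMochizuki40` class; false at Szpiro-deep slots
  with a `D`-type blur, which is the kernel content of `Thm311.Real.not_licence_settingDHVolSharp_of_deep_unramified`);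
* `heightIneq_of_forall_need_le_blur` — … and the delivered global inequality is then the SUM of those slot inequalities:
  REDUNDANT given the licence's own validity locus (content-free relative to that locus);
* `exists_licensedPlacewise_iff` — conversely the placewise Szpiro condition is all there is: a licensed, placewise-priced
  hull ledger EXISTS iff `∀ i, κ i ≤ θ i + B i` (door A at each slot: `η := κ`);
* `exists_licensedGlobal_iff` — with a GLOBAL price a licensed hull ledger exists iff `HeightIneq B` itself (the costume lemma
  `IdentificationSocket.costumeLemma_holds` / `exists_priced_anchored_iff`, here for arbitrary image families);
* `heightIneq_not_imp_placewise` — the two localities DIFFER: a two-slot ledger satisfying the global height inequality and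
  violating the placewise one (across-place netting — census O-95 / socket exchange E3, ≡ Statement-strength).
READING for the MODEL-HUNT (neutral): a structure 𝓜 meeting (M1) «Reading M licensed with a non-trivial, finite hull bound» at a
witness setting carries EXACTLY the information «placewise NEED ≤ BLUR there» (if its price is a placewise theorem) or «global
NEED ≤ BLUR there» (if its price is global); the first is H1-03's class (dead at deep places, trivial elsewhere), the second is
the Statement's own strength (costume / `IUTDisputedClaim`). Hence (M1) ∧ (M2) is unsatisfiable AT THE REGION/VOLUME LAYER for
every image family, not only for the classes tried — the MODEL-CLASS TABLE of the memo records where each class of print/tree sits.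

§2 The arithmetic locus of Reading M AS TYPED (tame case). abc-iut-w4-d006 / w5-d180 decided the (xi-f) licence at the sharp
Dupuy–Hilado real setting at all-tame data: `Thm311.Real.licence_settingDHVolSharp_iff_of_tame_orders` — licence ⟺ at every bad
place `w | p` and label `j`: `e_p·((m_Θ(j,w) − 1) div e_p) + 1 − j·(e_p − 1) ≤ m_q(w)`. For REALISING ideles `m_Θ = j²·m_q`
(Dupuy–Hilado (3.4)) this file extracts the arithmetic content of that integer predicate:
* `tamePredicate_depth_le` — the predicate at `(e, m, j)` (`e ≥ 1`, `j ≥ 1`, any `m`) forces `(j − 1)·m ≤ e − 1` (tight at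
  `(e, m, j) = (2, 1, 2)`); `tamePredicate_of_sq_mul_le` — and `j²·m ≤ e` suffices. So Reading M as typed is licensed at a tame
  bad place only where the q-DEPTH is below the RAMIFICATION: `(ℓ⋇ − 1)·ord_w(q_w)/(2l) ≤ e_w − 1 ≤ d_w` (different exponent);
* `weightedSum_le_of_forall` — summing with the weights `f_w·log p_w ≥ 0`: on the licensed locus the q-pilot degree is at most
  `(ℓ⋇ − 1)⁻¹ ×` the bad part of the log-different — a height inequality STRONGER (by the factor ≈ ℓ⋇/3 against inv-2's NEED
  constant avgSq ℓ⋇ − 1 ≈ ℓ⋇²/3 per unit blur ≈ ℓ⋇·D) than the one Reading M then delivers: the locus where the typed reading has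
  teeth is Szpiro-trivial, i.e. it instantiates horn (b) «blur ≥ O(ℓ²)» of `Literature.Barriers.ABC.IUTDisputedClaim`'s
  because-clause rather than evading it. (Wild / dyadic bad places: outside this file; tree `Cor312LicenceWild*`.)
[cite: Mochizuki2012, IUTchIII Cor. 3.12 pp. 173–174, Step (xi-f) p. 184; IUTchIV Prop. 1.2 p. 10, Thm. 1.10]
[cite: DupuyHilado2025, §3.4, §3.9, §4.9] [cite: ScholzeStix2018, §2.2 pp. 9–10] [claim: Mochizuki2012, status: disputed]
-/

set_option linter.dupNamespace false

namespace Summit.ABC.ABC.Cruxes.ThetaPartII.ModelHunt5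

open Finset
open scoped BigOperators

/-! ## §1 The volume shadow of an arbitrary possible-images structure, slot by slot -/

/-- The per-slot log-volumes any possible-images structure 𝓜 induces at a witness setting: honest Θ-copy `θ`, q-region `κ`,
hull of the union of 𝓜's images `η`. No axiom is built in (existence is never smuggled into the interface). -/
structure SlotLedger (ι : Type) where
  /-- log-volume of the honest `q^{j²}`-scaled Θ-copy at the slot -/
  θ : ι → ℝ
  /-- log-volume of the q-pilot region at the slot -/
  κ : ι → ℝ
  /-- log-volume of the holomorphic hull of the union of all proposed images at the slot -/
  η : ι → ℝ

variable {ι : Type}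

/-- hull ⊇ the honest Θ-copy (every hull of a union containing the Θ-region). -/
def HullCoversTheta (L : SlotLedger ι) : Prop := ∀ i, L.θ i ≤ L.η i

/-- the Θ-cell lies inside the q-cell at every slot (`‖t_Θ,j‖ = ‖t_q‖^{j²} ≤ ‖t_q‖`). -/
def ThetaInsideQ (L : SlotLedger ι) : Prop := ∀ i, L.θ i ≤ L.κ i

/-- volume shadow of the set-level (xi-f) licence `qRegion ⊆ thetaHull`, slot by slot. -/
def SetLicensed (L : SlotLedger ι) : Prop := ∀ i, L.κ i ≤ L.η i

/-- a PLACEWISE price: hull volume ≤ honest volume + blur budget, at every slot. -/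
def PricedPlacewise (L : SlotLedger ι) (B : ι → ℝ) : Prop := ∀ i, L.η i ≤ L.θ i + B i

/-- a GLOBAL price: only the sums are compared. -/
def PricedGlobal [Fintype ι] (L : SlotLedger ι) (B : ι → ℝ) : Prop := ∑ i, L.η i ≤ ∑ i, L.θ i + ∑ i, B i

/-- the delivered Corollary-shaped statement `−|log q| ≤ −|log Θ_hull|`. -/
def Delivers [Fintype ι] (L : SlotLedger ι) : Prop := ∑ i, L.κ i ≤ ∑ i, L.η i

/-- the delivered height inequality NEED ≤ BLUR (Szpiro shape). -/
def HeightIneq [Fintype ι] (L : SlotLedger ι) (B : ι → ℝ) : Prop := ∑ i, (L.κ i - L.θ i) ≤ ∑ i, B i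

/-- the placewise height condition (H1-03's class). -/
def PlacewiseHeight (L : SlotLedger ι) (B : ι → ℝ) : Prop := ∀ i, L.κ i - L.θ i ≤ B i

/-- Licensed ∧ placewise-priced ⟹ NEED ≤ BLUR at every slot. -/
theorem need_le_blur_of_licensed_placewise (L : SlotLedger ι) (B : ι → ℝ)
    (hlic : SetLicensed L) (hpr : PricedPlacewise L B) : PlacewiseHeight L B := by
  intro i
  have h1 := hlic i
  have h2 := hpr i
  linarith

/-- … and the delivered global height inequality is the SUM of the slot conditions (redundant given the licence locus). -/
theorem heightIneq_of_forall_need_le_blur [Fintype ι] (L : SlotLedger ι) (B : ι → ℝ) (h : PlacewiseHeight L B) :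
    HeightIneq L B := by
  unfold HeightIneq
  exact Finset.sum_le_sum fun i _ => h i

/-- Licensed ⟹ the Corollary-shaped statement, by summation (the volume form of `Thm311ToCor312.statement_of_licence`). -/
theorem delivers_of_licensed [Fintype ι] (L : SlotLedger ι) (hlic : SetLicensed L) : Delivers L := by
  unfold Delivers
  exact Finset.sum_le_sum fun i _ => hlic i

/-- Licensed ∧ globally priced ⟹ the global height inequality (the socket's `gap_le_of_socket`, for any image family). -/
theorem heightIneq_of_licensed_global [Fintype ι] (L : SlotLedger ι) (B : ι → ℝ)
    (hlic : SetLicensed L) (hpr : PricedGlobal L B) : HeightIneq L B := by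
  unfold HeightIneq
  have h := delivers_of_licensed L hlic
  unfold Delivers at h
  unfold PricedGlobal at hpr
  rw [Finset.sum_sub_distrib]
  linarith

/-- DOOR A, placewise: given the honest volumes `θ`, `κ` with the Θ-cell inside the q-cell, a licensed placewise-priced hull
ledger EXISTS iff the placewise height condition holds (witness `η := κ`, the q-container slot by slot). -/
theorem exists_licensedPlacewise_iff (θ κ : ι → ℝ) (B : ι → ℝ) (hθκ : ∀ i, θ i ≤ κ i) :
    (∃ η : ι → ℝ, HullCoversTheta ⟨θ, κ, η⟩ ∧ SetLicensed ⟨θ, κ, η⟩ ∧ PricedPlacewise ⟨θ, κ, η⟩ B) ↔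
      ∀ i, κ i - θ i ≤ B i := by
  constructor
  · rintro ⟨η, _, hlic, hpr⟩ i
    exact need_le_blur_of_licensed_placewise ⟨θ, κ, η⟩ B hlic hpr i
  · intro h
    refine ⟨κ, fun i => hθκ i, fun i => le_rfl, fun i => ?_⟩
    have := h i
    show κ i ≤ θ i + B i
    linarith

/-- DOOR A, global: with a GLOBAL price a licensed hull ledger exists iff the global height inequality itself
(the costume lemma for arbitrary image families). -/
theorem exists_licensedGlobal_iff [Fintype ι] (θ κ : ι → ℝ) (B : ι → ℝ) (hθκ : ∀ i, θ i ≤ κ i) :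
    (∃ η : ι → ℝ, HullCoversTheta ⟨θ, κ, η⟩ ∧ SetLicensed ⟨θ, κ, η⟩ ∧ PricedGlobal ⟨θ, κ, η⟩ B) ↔
      HeightIneq ⟨θ, κ, κ⟩ B := by
  constructor
  · rintro ⟨η, _, hlic, hpr⟩
    have h := heightIneq_of_licensed_global ⟨θ, κ, η⟩ B hlic hpr
    unfold HeightIneq at h ⊢
    exact h
  · intro h
    refine ⟨κ, fun i => hθκ i, fun i => le_rfl, ?_⟩
    unfold HeightIneq at h
    show ∑ i, κ i ≤ ∑ i, θ i + ∑ i, B i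
    rw [Finset.sum_sub_distrib] at h
    linarith

/-- The two localities DIFFER (across-place netting): two slots, `θ = 0`, `κ = (2, 0)`, `B = (1, 1)` — the global height
inequality holds (`2 ≤ 2`) and the placewise one fails at the first slot (`2 ≰ 1`). -/
theorem heightIneq_not_imp_placewise :
    ∃ (L : SlotLedger (Fin 2)) (B : Fin 2 → ℝ), HeightIneq L B ∧ ¬ PlacewiseHeight L B := by
  refine ⟨⟨fun _ => 0, ![2, 0], ![2, 0]⟩, ![1, 1], ?_, ?_⟩
  · unfold HeightIneq
    simp [Fin.sum_univ_two]
    norm_num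
  · unfold PlacewiseHeight
    intro h
    have h0 := h 0
    revert h0
    norm_num

/-! ## §2 The arithmetic locus of Reading M as typed (tame case): the integer predicate of
`licence_settingDHVolSharp_iff_of_tame_orders` at realising ideles `m_Θ = j²·m_q` -/

/-- The tame-orders licence predicate at one (index, depth, label). -/
def TamePredicate (e m j : ℤ) : Prop := e * ((j ^ 2 * m - 1) / e) + 1 - j * (e - 1) ≤ m

/-- **Licensed ⟹ depth below ramification**: the predicate forces `(j − 1)·m ≤ e − 1` (tight at `e = 2, m = 1, j = 2`). -/
theorem tamePredicate_depth_le {e m j : ℤ} (he : 1 ≤ e) (hj : 1 ≤ j) (h : TamePredicate e m j) :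
    (j - 1) * m ≤ e - 1 := by
  unfold TamePredicate at h
  have he0 : e ≠ 0 := by omega
  have hdiv : e * ((j ^ 2 * m - 1) / e) + (j ^ 2 * m - 1) % e = j ^ 2 * m - 1 := Int.mul_ediv_add_emod _ _
  have hr0 : 0 ≤ (j ^ 2 * m - 1) % e := Int.emod_nonneg _ he0
  have hre : (j ^ 2 * m - 1) % e < e := Int.emod_lt_of_pos _ (by omega)
  -- (j² − 1)·m ≤ r + j(e−1) ≤ (j+1)(e−1)
  have key : (j + 1) * ((j - 1) * m) ≤ (j + 1) * (e - 1) := by nlinarith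
  exact le_of_mul_le_mul_left key (by omega)

/-- The tight instance: `e = 2`, `m = 1`, `j = 2` is licensed and meets `(j−1)·m = e−1`. -/
theorem tamePredicate_two_one_two : TamePredicate 2 1 2 := by
  unfold TamePredicate
  decide

/-- The generic deep unramified instance is NOT licensed: `e = 1`, `m ≥ 1`, `j ≥ 2` (the integer face of
`not_licence_settingDHVolSharp_of_deep_unramified`). -/
theorem not_tamePredicate_unramified {m j : ℤ} (hm : 1 ≤ m) (hj : 2 ≤ j) : ¬ TamePredicate 1 m j := by
  intro h
  have := tamePredicate_depth_le (e := 1) le_rfl (by omega) h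
  nlinarith

/-- **Heavy ramification suffices**: `j²·m ≤ e` ⟹ licensed (then `(j²m − 1) div e = 0`). -/
theorem tamePredicate_of_sq_mul_le {e m j : ℤ} (hm : 1 ≤ m) (hj : 1 ≤ j) (h : j ^ 2 * m ≤ e) :
    TamePredicate e m j := by
  unfold TamePredicate
  have h0 : 0 ≤ j ^ 2 * m - 1 := by nlinarith
  have hlt : j ^ 2 * m - 1 < e := by omega
  have hq : (j ^ 2 * m - 1) / e = 0 := Int.ediv_eq_zero_of_lt h0 hlt
  rw [hq, mul_zero]
  nlinarith

/-- Summation bookkeeping: slotwise `(L−1)·m_w ≤ d_w` with weights `c_w ≥ 0` gives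
`(L−1)·∑ c_w m_w ≤ ∑ c_w d_w` — on the licensed tame locus the q-pilot degree is at most `(ℓ⋇−1)⁻¹ ×` the bad log-different. -/
theorem weightedSum_le_of_forall {W : Type} [Fintype W] (L : ℝ) (c m d : W → ℝ) (hc : ∀ w, 0 ≤ c w)
    (h : ∀ w, (L - 1) * m w ≤ d w) : (L - 1) * ∑ w, c w * m w ≤ ∑ w, c w * d w := by
  rw [Finset.mul_sum]
  refine Finset.sum_le_sum fun w _ => ?_
  have := mul_le_mul_of_nonneg_left (h w) (hc w)
  linarith [this]

end Summit.ABC.ABC.Cruxes.ThetaPartII.ModelHunt5
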